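import Literature.NumberTheory.LFunctions.CertifiedLFunctionFourierTheta
import Mathlib.Analysis.SumIntegralComparisons
import HarnessLib

/-!
# Platt's Algorithm 2: the aliasing sums `Σ_{k ≥ 0} F̂(x + 2πkA)` and `Σ_{k ∈ ℤ} F̂(2πn/B + 2πkA)`
# (Math. Comp. 85 (2016) §7.2, Lemmas 7.4–7.5)

Topic `Literature/NumberTheory/LFunctions`; namespace `Literature.NumberTheory.LFunctions`, engine
sub-namespace `FourierTail`. Everything in this file is PROVED (no named fact, no new definition).
Typed for the parity-realchar cell (D-0088 (4) literature-typing layer, row «Platt 2016 (Math. Comp.,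
certified GRH/`L`-function computations)»): instrument provenance for "Algorithm 2" of Platt's GRH
verification `Literature.NumberTheory.LFunctions.platt2016_theorem71/72`
(`DirichletLRiemannHypothesisUpTo.lean`). Step (2) of the algorithm (p. 3017) uses `F̂_e(2πn/B)` as an
approximation to the periodised `Σ_{k ∈ ℤ} F̂_e(2πn/B + 2πkA)`; §7.2 "Approximating" bounds the error,
starting from the one-sided tail sums of **Lemma 7.4 (Booker)**, which Platt obtains as "Lemma 5.6 of [3]
specialised to Dirichlet `L`-functions" ([3] = Booker, Experiment. Math. 15 (2006)), and folding the
two-sided periodisation `F̃̂(n, χ) := Σ_{k ∈ ℤ} F̂(2πn/B + 2πkA, χ)` (p. 3017) onto two such tails in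
**Lemma 7.5**.

Source: D. J. Platt, *Numerical computations concerning the GRH*, Math. Comp. **85** (2016) 3009–3027
[Platt2016GRH], §7.2 pp. 3019–3020 (journal pdf, AMS open access; page-checked), `F_e`, `F_o`, `F̂`, `F̃̂`
of p. 3017. Numbering: journal Lemmas 7.4/7.5 = arXiv:1305.3087v1 Lemmas 5.4/5.5 (where `X(x)` is
misprinted; the journal's `X(x) = πδe^{2x-δ}/q` is Booker's `X = π r δ e^{-δ}(e^x/√N)^{2/r}` at `r = 1`,
`N = q`).

## Contents (all proved)

* `platt2016_lemma74_even`, `platt2016_lemma74_odd` — **Lemma 7.4 as printed**: for `η ∈ (-1, 1)`,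
  `δ := (π/2)(1 - |η|)`, `X(x) := πδ e^{2x-δ}/q > 1` (and `A > 0`, `|ε_χ| = 1`, `χ` primitive mod `q > 1`),
  `|Σ_{k=0}^∞ F̂_e(x + 2πkA, χ)| ≤ 4 exp(x/2 - X(x)) (1 + 1/(2X(x))) / (δ^{1/2} q^{1/4} (1 - e^{-πA}))` (`χ` even),
  `|Σ_{k=0}^∞ F̂_o(x + 2πkA, χ)| ≤ 4 exp(3x/2 - X(x)) (1 + 1/(2X(x)))^{3/2} / (δ^{1/2} q^{3/4} (1 - e^{-πA}))`
  (`χ` odd), with `F̂(y, χ) = (1/(2π)) ∫ F(t, χ) e^{-iyt} dt` written out as in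
  `CertifiedLFunctionFourierTheta.lean`.
* `platt2016_lemma74` — both parities at once with the sharper constant the direct proof gives:
  `≤ 2 e^{(1/2+a)x - X}(1 + 1/(2X)) q^{-(1/2+a)/2}/(1 - e^{-πA})`, `a = charParity χ`, for `X ≥ 1`.
* `platt2016_lemma75_even`, `platt2016_lemma75_odd` — **Lemma 7.5 as printed**: for `A > 0`, `n ∈ ℤ`,
  `w₁ = 2πn/B + 2πA`, `w₂ = -2πn/B + 2πA`, `X(w₁), X(w₂) > 1`,
  `|F̃̂_e(n, χ) - F̂_e(2πn/B, χ)| ≤ 4 (e^{w₁/2 - X(w₁)}(1 + 1/(2X(w₁))) + e^{w₂/2 - X(w₂)}(1 + 1/(2X(w₂)))) / (q^{1/4} δ^{1/2} (1 - e^{-πA}))`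
  and the odd analogue (`e^{3w/2 - X(w)}(1 + 1/(2X(w)))^{3/2}`, `q^{3/4}`). `F̂` enters as a function
  `Fhat` together with its defining equation, and the printed proof's "Now, `F_e(x, χ)` is real valued"
  (Platt's standing choice of `ε_χ`, p. 3009) is an explicit hypothesis `hreal`.
* Engine (`FourierTail.*`): `norm_fourier_le` — from the theta series of Lemmas 7.1/7.2
  (`platt2016_lemma71_72`), `|F̂(y, χ)| ≤ 2 e^{(1/2+a)y} q^{-(1/2+a)/2} e^{-X(y)}(1 + 1/(2X(y)))` for
  `X(y) ≥ 1`; `tsum_pow_mul_exp_le` — `Σ_{n ≥ 1} n^a e^{-Xn²} ≤ e^{-X}(1 + 1/(2X))` (`a ∈ {0,1}`,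
  `X ≥ 1`; integral test); `norm_fourier_shift_le` — the `k`-th shifted term is at most `e^{-πkA}` times
  the bound at `k = 0` (`X(x + 2πkA) = X(x)e^{4πkA}`).

## Method

Platt cites Booker's general Lemma 5.6 (degree-`r` `L`-functions, `K`-Bessel majorants). For `r = 1` the
bound follows directly from Lemmas 7.1/7.2, and that is the road taken here (shorter than vendoring
Booker's §5): (i) `|exp(-πn²e^{2u}/q)| = exp(-πn²e^{2y}cos(πη/2)/q)` and `cos(πη/2) = sin δ ≥ δe^{-δ}`
(`δ ≤ π/2 < 2`; `sin δ > δ - δ³/6 ≥ δ/(1+δ) ≥ δe^{-δ}`), so the `n`-th term of the theta series at `y`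
is at most `n^a e^{-X(y)n²}`; (ii) `t^a e^{-Xt²}` is decreasing on `[1, ∞)` for `X ≥ 1`, so
`Σ_{n≥2} n^a e^{-Xn²} ≤ ∫_1^∞ t e^{-Xt²} dt = e^{-X}/(2X)`; (iii) `X(x + 2πkA) = X(x) e^{4πkA}` and
`e^{4πkA} - 1 ≥ 4πkA`, so for `X ≥ 1` the `k`-th bound is at most `e^{-πkA}` times the `0`-th (as in
Booker's proof: "to pass from this to the `k`th term, we multiply by a factor not exceeding … `e^{-πkA}`");
(iv) the geometric series gives `1/(1 - e^{-πA})`; (v) `2 ≤ 4/δ^{1/2}` (`δ ≤ π/2`) and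
`1 + 1/(2X) ≤ (1 + 1/(2X))^{3/2}` recover the printed constants. Lemma 7.5 (printed proof, p. 3019):
`F̃̂_e(n) = F̂_e(2πn/B) + Σ_{k≥1} F̂_e(2πn/B + 2πkA) + Σ_{k≥1} F̂_e(2πn/B - 2πkA)`; "`F_e(x, χ)` is real valued,
so `F̂_e(x, χ) = conj F̂_e(-x, χ)`" turns the last sum into `conj Σ_{k≥0} F̂_e(w₂ + 2πkA)`, the middle one is
`Σ_{k≥0} F̂_e(w₁ + 2πkA)`, "and the result follows using Lemma 7.4 with `x = ±2πn/B + 2πA`" (the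
`ℤ`-indexed sum is split with Mathlib's `tsum_of_nat_of_neg_add_one`).

NOT here: the realness of `F_e`, `F_o` for Platt's `ε_χ` (a root-number computation; taken as the
hypothesis `hreal` of Lemma 7.5, exactly as the printed proof uses it), Lemma 7.6 (time-domain aliasing
via Booker's Lemma 5.7 and Lemma 7.3), and the truncation of the theta series. Platt states Lemma 7.5
for `A ≥ 1/(2π)`, `B > 0`; the proof (and this file) needs only `A > 0`.

`lean search` (2026-08-27): no tail bound of this shape in the tree (`lean search 'F̂|2 \* π \* k \* A'`);
Mathlib supplies `AntitoneOn.sum_le_integral`, `Real.sin_gt_sub_cube`, `Real.add_one_le_exp`,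
`tsum_geometric_of_lt_one`, `norm_tsum_le_tsum_norm`. Nothing is restated.

## References

* [Platt2016GRH] D. J. Platt, *Numerical computations concerning the GRH*, Math. Comp. 85 (2016),
  no. 302, 3009–3027, doi:10.1090/mcom/3077: §7.2 "Approximating", Lemmas 7.4–7.5 p. 3019, proof of
  Lemma 7.5 pp. 3019–3020 (arXiv:1305.3087v1 Lemmas 5.4–5.5).
* [Booker2006] A. R. Booker, *Artin's conjecture, Turing's method, and the Riemann hypothesis*,
  Experiment. Math. 15 (2006) 385–407, Lemma 5.6 (Platt's source; arXiv:math/0507502 §5).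
-/

noncomputable section

open Complex Filter Topology Set MeasureTheory DirichletCharacter
open scoped Real Nat

namespace Literature.NumberTheory.LFunctions

namespace FourierTail

/-! ## §1 Real inequalities: `sin δ ≥ δe^{-δ}` and the Gaussian tail sum -/

/-- `δ e^{-δ} ≤ sin δ` for `0 < δ ≤ π/2` (`sin δ > δ - δ³/6 ≥ δ/(1+δ) ≥ δ e^{-δ}`, using `δ < 2`). [folklore] -/
private theorem mul_exp_neg_le_sin {δ : ℝ} (h0 : 0 < δ) (h1 : δ ≤ π / 2) : δ * Real.exp (-δ) ≤ Real.sin δ := by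
  have hδ2 : δ < 2 := by linarith [Real.pi_lt_four]
  have hsin := Real.sin_gt_sub_cube h0
  -- `δ e^{-δ} ≤ δ/(1+δ)`
  have hexp : Real.exp (-δ) ≤ 1 / (1 + δ) := by
    rw [Real.exp_neg, one_div]
    exact inv_anti₀ (by linarith) (by linarith [Real.add_one_le_exp δ])
  have h2 : δ * Real.exp (-δ) ≤ δ / (1 + δ) := by
    calc δ * Real.exp (-δ) ≤ δ * (1 / (1 + δ)) := mul_le_mul_of_nonneg_left hexp h0.le
      _ = δ / (1 + δ) := by ring
  -- `δ/(1+δ) ≤ δ - δ³/6` for `δ < 2`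
  have h3 : δ / (1 + δ) ≤ δ - δ ^ 3 / 6 := by
    rw [div_le_iff₀ (by linarith)]
    nlinarith [mul_pos h0 h0, mul_pos (mul_pos h0 h0) (show (0 : ℝ) < 2 - δ by linarith),
      mul_pos (mul_pos h0 h0) (show (0 : ℝ) < 3 + δ by linarith)]
  linarith

/-- `t ↦ t^a e^{-Xt²}` is antitone on `[1, ∞)` for `a ≤ 1`, `X ≥ 1`. [folklore] -/
private theorem pow_mul_exp_antitoneOn (a : ℕ) (ha : a ≤ 1) {X : ℝ} (hX : 1 ≤ X) :
    AntitoneOn (fun t : ℝ => t ^ a * Real.exp (-(X * t ^ 2))) (Ici 1) := by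
  intro s hs t ht hst
  simp only [mem_Ici] at hs ht
  simp only
  have hkey : Real.exp (-(X * t ^ 2)) * Real.exp (X * (t ^ 2 - s ^ 2)) = Real.exp (-(X * s ^ 2)) := by
    rw [← Real.exp_add]; congr 1; ring
  have hE : X * (t ^ 2 - s ^ 2) + 1 ≤ Real.exp (X * (t ^ 2 - s ^ 2)) := Real.add_one_le_exp _
  have hts : 0 ≤ t - s := sub_nonneg.2 hst
  interval_cases a
  · simp only [pow_zero, one_mul]
    rw [← hkey]
    apply le_mul_of_one_le_right (Real.exp_pos _).le
    refine le_trans ?_ hE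
    nlinarith [mul_nonneg hts (show 0 ≤ t + s by linarith)]
  · simp only [pow_one]
    rw [← hkey]
    -- `t ≤ s · e^{X(t²-s²)}`
    have h1 : 0 ≤ (t - s) * (s * X * (t + s) - 1) :=
      mul_nonneg hts (by nlinarith [mul_nonneg (show (0:ℝ) ≤ s - 1 by linarith) (show (0:ℝ) ≤ X - 1 by linarith)])
    have h2 : s * (X * (t ^ 2 - s ^ 2) + 1) - t = (t - s) * (s * X * (t + s) - 1) := by ring
    have hmain : t ≤ s * Real.exp (X * (t ^ 2 - s ^ 2)) :=
      le_trans (by linarith) (mul_le_mul_of_nonneg_left hE (by linarith))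
    calc t * Real.exp (-(X * t ^ 2)) = Real.exp (-(X * t ^ 2)) * t := mul_comm _ _
      _ ≤ Real.exp (-(X * t ^ 2)) * (s * Real.exp (X * (t ^ 2 - s ^ 2))) :=
          mul_le_mul_of_nonneg_left hmain (Real.exp_pos _).le
      _ = s * (Real.exp (-(X * t ^ 2)) * Real.exp (X * (t ^ 2 - s ^ 2))) := by ring

/-- `∫_1^{1+M} t e^{-Xt²} dt ≤ e^{-X}/(2X)` (`X > 0`; primitive `-e^{-Xt²}/(2X)`). [folklore] -/
private theorem integral_mul_exp_le {X : ℝ} (hX : 0 < X) (M : ℕ) :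
    ∫ t in (1 : ℝ)..(1 + M), t * Real.exp (-(X * t ^ 2)) ≤ Real.exp (-X) / (2 * X) := by
  have hderiv : ∀ t ∈ uIcc (1 : ℝ) (1 + M),
      HasDerivAt (fun t : ℝ => -Real.exp (-(X * t ^ 2)) / (2 * X)) (t * Real.exp (-(X * t ^ 2))) t := by
    intro t _
    have h1 : HasDerivAt (fun t : ℝ => -(X * t ^ 2)) (-(X * (((2 : ℕ) : ℝ) * t ^ (2 - 1) * 1))) t :=
      (((hasDerivAt_id' t).pow 2).const_mul X).neg
    have h2 : HasDerivAt (fun t : ℝ => -Real.exp (-(X * t ^ 2)) / (2 * X))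
        (-(Real.exp (-(X * t ^ 2)) * -(X * (((2 : ℕ) : ℝ) * t ^ (2 - 1) * 1))) / (2 * X)) t :=
      (h1.exp.neg).div_const (2 * X)
    convert h2 using 1
    rw [eq_div_iff (by positivity : (2 * X : ℝ) ≠ 0)]
    push_cast
    ring
  have hint : IntervalIntegrable (fun t : ℝ => t * Real.exp (-(X * t ^ 2))) volume 1 (1 + M) :=
    (by fun_prop : Continuous fun t : ℝ => t * Real.exp (-(X * t ^ 2))).intervalIntegrable _ _
  rw [intervalIntegral.integral_eq_sub_of_hasDerivAt hderiv hint]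
  have hpos : 0 < Real.exp (-(X * (1 + (M : ℝ)) ^ 2)) := Real.exp_pos _
  have : -Real.exp (-(X * (1 + (M : ℝ)) ^ 2)) / (2 * X) - -Real.exp (-(X * (1 : ℝ) ^ 2)) / (2 * X) =
      Real.exp (-X) / (2 * X) - Real.exp (-(X * (1 + (M : ℝ)) ^ 2)) / (2 * X) := by
    rw [one_pow, mul_one]; ring
  rw [this]
  linarith [div_pos hpos (by positivity : (0 : ℝ) < 2 * X)]

/-- **Gaussian tail sum:** `Σ_{n ≥ 1} n^a e^{-Xn²} ≤ e^{-X}(1 + 1/(2X))` for `a ∈ {0, 1}`, `X ≥ 1` —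
the first term plus the integral test (`AntitoneOn.sum_le_integral`) for the rest,
`Σ_{n ≥ 2} n^a e^{-Xn²} ≤ ∫_1^∞ t e^{-Xt²} dt = e^{-X}/(2X)`; the source of the factor `1 + 1/(2X(x))` in
Lemma 7.4. [cite: Platt2016GRH, Lemma 7.4 p. 3019 (proof: via Lemmas 7.1–7.2)] -/
theorem tsum_pow_mul_exp_le (a : ℕ) (ha : a ≤ 1) {X : ℝ} (hX : 1 ≤ X) :
    ∑' n : ℕ, ((n + 1 : ℕ) : ℝ) ^ a * Real.exp (-(X * ((n + 1 : ℕ) : ℝ) ^ 2)) ≤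
      Real.exp (-X) * (1 + 1 / (2 * X)) := by
  have hX0 : 0 < X := by linarith
  set f : ℝ → ℝ := fun t => t ^ a * Real.exp (-(X * t ^ 2)) with hf
  have hf1 : f 1 = Real.exp (-X) := by simp [hf]
  have hanti := pow_mul_exp_antitoneOn a ha hX
  refine Real.tsum_le_of_sum_range_le (fun n => by positivity) fun N => ?_
  rcases Nat.eq_zero_or_pos N with rfl | hN
  · simp only [Finset.range_zero, Finset.sum_empty]; positivity
  obtain ⟨M, rfl⟩ : ∃ M, N = M + 1 := ⟨N - 1, by omega⟩
  rw [Finset.sum_range_succ']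
  simp only [zero_add, Nat.cast_one, one_pow, one_mul, mul_one]
  -- the tail via the integral test
  have htail : ∑ i ∈ Finset.range M, (((i + 1 + 1 : ℕ) : ℝ)) ^ a *
      Real.exp (-(X * ((i + 1 + 1 : ℕ) : ℝ) ^ 2)) ≤ Real.exp (-X) / (2 * X) := by
    have h := AntitoneOn.sum_le_integral (x₀ := (1 : ℝ)) (a := M) (f := f)
      (hanti.mono (fun t ht => by simp only [mem_Icc] at ht; exact ht.1))
    have hcongr : ∑ i ∈ Finset.range M, (((i + 1 + 1 : ℕ) : ℝ)) ^ a *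
        Real.exp (-(X * ((i + 1 + 1 : ℕ) : ℝ) ^ 2)) =
        ∑ i ∈ Finset.range M, f (1 + ((i + 1 : ℕ) : ℝ)) := by
      refine Finset.sum_congr rfl fun i _ => ?_
      simp only [hf]; push_cast; ring_nf
    rw [hcongr]
    refine h.trans ?_
    have hmono : ∫ t in (1 : ℝ)..(1 + M), f t ≤ ∫ t in (1 : ℝ)..(1 + M), t * Real.exp (-(X * t ^ 2)) := by
      refine intervalIntegral.integral_mono_on (by simp) ?_ ?_ fun t ht => ?_
      · exact (by fun_prop : Continuous f).intervalIntegrable _ _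
      · exact (by fun_prop : Continuous fun t : ℝ => t * Real.exp (-(X * t ^ 2))).intervalIntegrable _ _
      · simp only [hf]
        refine mul_le_mul_of_nonneg_right ?_ (Real.exp_pos _).le
        interval_cases a
        · simp only [pow_zero]; exact ht.1
        · simp
    exact hmono.trans (integral_mul_exp_le hX0 M)
  have hfinal : Real.exp (-X) * (1 + 1 / (2 * X)) = Real.exp (-X) / (2 * X) + Real.exp (-X) := by ring
  rw [hfinal]
  exact add_le_add htail le_rfl

/-! ## §2 The size of `F̂(y, χ)` -/

/-- **The size of `F̂(y, χ)`:** for `χ` primitive mod `q > 1`, `|ε| = 1`, `|η| < 1` and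
`X(y) = πδe^{2y-δ}/q ≥ 1` (`δ = (π/2)(1-|η|)`),
`|F̂(y, χ)| ≤ 2 e^{(1/2+a)y} q^{-(1/2+a)/2} e^{-X(y)} (1 + 1/(2X(y)))`, `a = charParity χ`, from the theta
series of Lemmas 7.1/7.2 (`platt2016_lemma71_72`): the `n`-th term has modulus
`n^a exp(-πn²e^{2y}cos(πη/2)/q) ≤ n^a e^{-X(y)n²}` because `cos(πη/2) = sin δ ≥ δe^{-δ}`, and
`FourierTail.tsum_pow_mul_exp_le` sums them. [cite: Platt2016GRH, Lemma 7.4 p. 3019 (proof: via Lemmas 7.1–7.2)] -/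
theorem norm_fourier_le {q : ℕ} [NeZero q] (hq : 1 < q) {χ : DirichletCharacter ℂ q}
    (hχ : χ.IsPrimitive) {ε : ℂ} (hε : ‖ε‖ = 1) {η : ℝ} (hη : |η| < 1) (y : ℝ) {Xy : ℝ}
    (hXy : Xy = π * (π / 2 * (1 - |η|)) * Real.exp (2 * y - π / 2 * (1 - |η|)) / q)
    (hX1 : 1 ≤ Xy) :
    ‖1 / (2 * π) * ∫ t : ℝ, ε * (q : ℂ) ^ (I * t / 2) * (π : ℂ) ^ (-(1 / 2 + charParity χ + I * t) / 2) *
          Complex.Gamma ((1 / 2 + charParity χ + I * t) / 2) * Complex.exp (π * η * t / 4) *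
          χ.LFunction (1 / 2 + I * t) * Complex.exp (-I * y * t)‖ ≤
      2 * Real.exp ((1 / 2 + charParity χ) * y) *
        (q : ℝ) ^ (-((1 / 2 + (charParity χ : ℝ)) / 2)) * (Real.exp (-Xy) * (1 + 1 / (2 * Xy))) := by
  haveI : Fact (1 < q) := ⟨hq⟩
  rw [platt2016_lemma71_72 hq hχ ε hη y]
  set a : ℕ := charParity χ with ha
  have ha1 : a ≤ 1 := charParity_le_one χ
  set δ : ℝ := π / 2 * (1 - |η|) with hδ
  have hη0 : 0 ≤ |η| := abs_nonneg η
  have hδ0 : 0 < δ := by rw [hδ]; nlinarith [Real.pi_pos]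
  have hδ1 : δ ≤ π / 2 := by rw [hδ]; nlinarith [Real.pi_pos]
  have hqpos : (0 : ℝ) < q := by exact_mod_cast (show 0 < q by omega)
  have hXy0 : 0 < Xy := by linarith
  -- the prefactor
  have n1 : ‖(2 : ℂ) * ε * Complex.exp ((1 / 2 + (a : ℂ)) * (π * η * I / 4 + y)) *
      (q : ℂ) ^ (-((1 / 2 + (a : ℂ)) / 2) : ℂ)‖ =
      2 * Real.exp ((1 / 2 + a) * y) * (q : ℝ) ^ (-((1 / 2 + (a : ℝ)) / 2)) := by
    rw [norm_mul, norm_mul, norm_mul, hε, mul_one, Complex.norm_exp]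
    have hre : ((1 / 2 + (a : ℂ)) * (π * η * I / 4 + y)).re = (1 / 2 + a) * y := by
      simp
    have hq' : ‖(q : ℂ) ^ (-((1 / 2 + (a : ℂ)) / 2) : ℂ)‖ = (q : ℝ) ^ (-((1 / 2 + (a : ℝ)) / 2)) := by
      rw [show (q : ℂ) = ((q : ℝ) : ℂ) by simp, Complex.norm_cpow_eq_rpow_re_of_pos hqpos]
      congr 1; simp
    rw [hre, hq']
    simp
  -- `Re z_n ≥ X(y) n²`
  have hre_z : ∀ n : ℕ, Xy * (n : ℝ) ^ 2 ≤
      ((π * n ^ 2 * Complex.exp (2 * (π * η * I / 4 + y)) / q : ℂ)).re := by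
    intro n
    have hz : ((π * n ^ 2 * Complex.exp (2 * (π * η * I / 4 + y)) / q : ℂ)) =
        ((π * n ^ 2 / q : ℝ) : ℂ) * Complex.exp (2 * (π * η * I / 4 + y)) := by
      push_cast; ring
    have him : (2 * ((π : ℂ) * η * I / 4 + y)).im = π * η / 2 := by simp; ring
    have hre : (2 * ((π : ℂ) * η * I / 4 + y)).re = 2 * y := by simp
    rw [hz, Complex.re_ofReal_mul, Complex.exp_re, him, hre]
    have hcos : δ * Real.exp (-δ) ≤ Real.cos (π * η / 2) := by
      have h1 : Real.cos (π * η / 2) = Real.sin δ := by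
        rw [← Real.cos_abs, show |π * η / 2| = π * |η| / 2 by
          rw [abs_div, abs_mul, abs_of_pos Real.pi_pos, abs_two], ← Real.sin_pi_div_two_sub]
        congr 1; rw [hδ]; ring
      rw [h1]; exact mul_exp_neg_le_sin hδ0 hδ1
    have hX' : Xy * (n : ℝ) ^ 2 = π * n ^ 2 / q * (Real.exp (2 * y) * (δ * Real.exp (-δ))) := by
      rw [hXy, Real.exp_sub, Real.exp_neg]; field_simp
    rw [hX']
    gcongr
  -- termwise majorant `g`
  set g : ℕ → ℝ := fun n => ‖χ n‖ * ((n : ℝ) ^ a * Real.exp (-(Xy * (n : ℝ) ^ 2))) with hg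
  have hterm : ∀ n : ℕ, ‖χ n * (n : ℂ) ^ a *
      Complex.exp (-(π * n ^ 2 * Complex.exp (2 * (π * η * I / 4 + y)) / q))‖ ≤ g n := by
    intro n
    rw [norm_mul, norm_mul, Complex.norm_exp, norm_pow, Complex.norm_natCast, hg, mul_assoc]
    simp only
    gcongr
    rw [Complex.neg_re]
    linarith [hre_z n]
  -- summability
  set m0 : ℕ → ℝ := fun n => (n : ℝ) ^ a * Real.exp (-(Xy * (n : ℝ) ^ 2)) with hm0
  have hm0sum : Summable m0 := by
    have hs := Real.summable_pow_mul_exp_neg_nat_mul a hXy0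
    refine Summable.of_nonneg_of_le (fun n => by positivity) (fun n => ?_) hs
    simp only [hm0]
    have hn2 : (n : ℝ) ≤ (n : ℝ) ^ 2 := by exact_mod_cast Nat.le_self_pow (by norm_num) n
    gcongr (n : ℝ) ^ a * Real.exp ?_
    rw [neg_mul]
    exact neg_le_neg (by nlinarith)
  have hgsum : Summable g := by
    refine Summable.of_nonneg_of_le (fun n => by positivity) (fun n => ?_) hm0sum
    simp only [hg, hm0]
    exact mul_le_of_le_one_left (by positivity) (DirichletCharacter.norm_le_one χ _)
  have hSnorm : Summable fun n : ℕ => ‖χ n * (n : ℂ) ^ a *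
      Complex.exp (-(π * n ^ 2 * Complex.exp (2 * (π * η * I / 4 + y)) / q))‖ :=
    Summable.of_nonneg_of_le (fun n => norm_nonneg _) hterm hgsum
  have hg0 : g 0 = 0 := by simp [hg, MulChar.map_zero χ]
  have hg_le : ∀ n : ℕ, g (n + 1) ≤ m0 (n + 1) := fun n => by
    simp only [hg, hm0]
    exact mul_le_of_le_one_left (by positivity) (DirichletCharacter.norm_le_one χ _)
  have hseries : ‖∑' n : ℕ, χ n * (n : ℂ) ^ a *
      Complex.exp (-(π * n ^ 2 * Complex.exp (2 * (π * η * I / 4 + y)) / q))‖ ≤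
      Real.exp (-Xy) * (1 + 1 / (2 * Xy)) := by
    calc _ ≤ ∑' n : ℕ, ‖χ n * (n : ℂ) ^ a *
          Complex.exp (-(π * n ^ 2 * Complex.exp (2 * (π * η * I / 4 + y)) / q))‖ :=
          norm_tsum_le_tsum_norm hSnorm
      _ ≤ ∑' n, g n := hSnorm.tsum_le_tsum hterm hgsum
      _ = ∑' n, g (n + 1) := by rw [hgsum.tsum_eq_zero_add, hg0, zero_add]
      _ ≤ ∑' n, m0 (n + 1) :=
          ((summable_nat_add_iff 1).mpr hgsum).tsum_le_tsum hg_le ((summable_nat_add_iff 1).mpr hm0sum)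
      _ ≤ Real.exp (-Xy) * (1 + 1 / (2 * Xy)) := by
          have h := tsum_pow_mul_exp_le a ha1 hX1
          simpa [hm0] using h
  rw [norm_mul, n1]
  exact mul_le_mul_of_nonneg_left hseries (by positivity)

/-- **From the `0`-th to the `k`-th term** (Booker's "to pass from this to the `k`th term, we multiply by
a factor not exceeding … `e^{-πkA}`"): for `X = X(x) ≥ 1`, `A > 0`, `k ∈ ℕ`,
`|F̂(x + 2πkA, χ)| ≤ 2 e^{(1/2+a)x - X} (1 + 1/(2X)) q^{-(1/2+a)/2} · e^{-πkA}`, because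
`X(x + 2πkA) = X e^{4πkA}` and `(1/2+a)·2πkA + πkA ≤ 4πkA ≤ X(e^{4πkA} - 1)`. Also the source of the
summability used in Lemma 7.5. [cite: Platt2016GRH, Lemma 7.4 p. 3019 (proof: via Lemmas 7.1–7.2)] -/
theorem norm_fourier_shift_le {q : ℕ} [NeZero q] (hq : 1 < q) {χ : DirichletCharacter ℂ q}
    (hχ : χ.IsPrimitive) {ε : ℂ} (hε : ‖ε‖ = 1) {η : ℝ} (hη : |η| < 1) (x : ℝ) {A : ℝ} (hA : 0 < A)
    {δ X : ℝ} (hδ : δ = π / 2 * (1 - |η|)) (hX : X = π * δ * Real.exp (2 * x - δ) / q)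
    (hX1 : 1 ≤ X) (k : ℕ) :
    ‖1 / (2 * π) * ∫ t : ℝ, ε * (q : ℂ) ^ (I * t / 2) * (π : ℂ) ^ (-(1 / 2 + charParity χ + I * t) / 2) *
          Complex.Gamma ((1 / 2 + charParity χ + I * t) / 2) * Complex.exp (π * η * t / 4) *
          χ.LFunction (1 / 2 + I * t) * Complex.exp (-I * ((x + 2 * π * k * A : ℝ) : ℂ) * t)‖ ≤
      2 * Real.exp ((1 / 2 + charParity χ) * x - X) * (1 + 1 / (2 * X)) *
        (q : ℝ) ^ (-((1 / 2 + (charParity χ : ℝ)) / 2)) * Real.exp (-(π * A)) ^ k := by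
  set a : ℕ := charParity χ with ha
  have ha1 : (a : ℝ) ≤ 1 := by exact_mod_cast charParity_le_one χ
  have ha0 : (0 : ℝ) ≤ a := Nat.cast_nonneg a
  have hX0 : 0 < X := by linarith
  have hkA : 0 ≤ π * k * A := by positivity
  set E : ℝ := Real.exp (4 * (π * k * A)) with hE
  have hE1 : 4 * (π * k * A) + 1 ≤ E := Real.add_one_le_exp _
  have hE1' : 1 ≤ E := by linarith
  have hXk : X * E = π * (π / 2 * (1 - |η|)) *
      Real.exp (2 * (x + 2 * π * k * A) - π / 2 * (1 - |η|)) / q := by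
    rw [hX, hδ, hE, div_mul_eq_mul_div, mul_assoc (π * (π / 2 * (1 - |η|))), ← Real.exp_add]
    congr 3; ring
  have hXk1 : 1 ≤ X * E := le_trans hX1 (le_mul_of_one_le_right hX0.le hE1')
  have hb := norm_fourier_le hq hχ hε hη (x + 2 * π * k * A) hXk hXk1
  refine hb.trans ?_
  have hrk : Real.exp (-(π * A)) ^ k = Real.exp (-(π * A) * k) := by rw [← Real.exp_nat_mul]; ring_nf
  have h1 : 1 + 1 / (2 * (X * E)) ≤ 1 + 1 / (2 * X) := by
    gcongr; exact le_mul_of_one_le_right hX0.le hE1'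
  have h2 : Real.exp ((1 / 2 + a) * (x + 2 * π * k * A)) * Real.exp (-(X * E)) ≤
      Real.exp ((1 / 2 + a) * x - X) * Real.exp (-(π * A) * k) := by
    rw [← Real.exp_add, ← Real.exp_add, Real.exp_le_exp]
    have h3 : 4 * (π * k * A) ≤ X * (E - 1) := by
      nlinarith [mul_nonneg hX0.le (show 0 ≤ E - 1 - 4 * (π * k * A) by linarith),
        mul_nonneg (show 0 ≤ X - 1 by linarith) (show 0 ≤ 4 * (π * k * A) by positivity)]
    nlinarith [mul_nonneg ha0 hkA]
  have hq0 : 0 ≤ (q : ℝ) ^ (-((1 / 2 + (a : ℝ)) / 2)) := Real.rpow_nonneg (Nat.cast_nonneg q) _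
  calc 2 * Real.exp ((1 / 2 + a) * (x + 2 * π * k * A)) * (q : ℝ) ^ (-((1 / 2 + (a : ℝ)) / 2)) *
        (Real.exp (-(X * E)) * (1 + 1 / (2 * (X * E))))
      = 2 * (q : ℝ) ^ (-((1 / 2 + (a : ℝ)) / 2)) *
        ((Real.exp ((1 / 2 + a) * (x + 2 * π * k * A)) * Real.exp (-(X * E))) *
          (1 + 1 / (2 * (X * E)))) := by ring
    _ ≤ 2 * (q : ℝ) ^ (-((1 / 2 + (a : ℝ)) / 2)) *
        ((Real.exp ((1 / 2 + a) * x - X) * Real.exp (-(π * A) * k)) * (1 + 1 / (2 * X))) := by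
        gcongr
    _ = _ := by rw [hrk]; ring

/-- `√δ ≤ 2` for `δ = (π/2)(1-|η|)` (as `π < 4`). [folklore] -/
private theorem sqrt_delta_le_two {η δ : ℝ} (hδ : δ = π / 2 * (1 - |η|)) : Real.sqrt δ ≤ 2 := by
  rw [Real.sqrt_le_left (by norm_num)]
  rw [hδ]; nlinarith [abs_nonneg η, Real.pi_lt_four, Real.pi_pos]

end FourierTail

open FourierTail

/-! ## §3 Lemma 7.4 -/

/-- **Platt 2016, Lemma 7.4, both parities, with the constant of the direct proof:** for `χ`
primitive mod `q > 1` of parity `a = charParity χ`, `|ε| = 1`, `η ∈ (-1, 1)`, `x ∈ ℝ`, `A > 0`,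
`δ = (π/2)(1 - |η|)`, `X = X(x) = πδe^{2x-δ}/q ≥ 1`,
`|Σ_{k ≥ 0} F̂(x + 2πkA, χ)| ≤ 2 e^{(1/2+a)x - X} (1 + 1/(2X)) q^{-(1/2+a)/2} / (1 - e^{-πA})`,
`F̂(y, χ) = (1/(2π)) ∫ F(t, χ) e^{-iyt} dt` with Platt's
`F(t, χ) = ε q^{it/2} π^{-(1/2+a+it)/2} Γ((1/2+a+it)/2) e^{πηt/4} L_χ(1/2+it)` (p. 3017) written out over
Mathlib's `DirichletCharacter.LFunction`/`Complex.Gamma` (the shift `y = x + 2πkA` enters as a real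
cast). The `k`-th term is at most `e^{-πkA}` times the bound for `k = 0` (`X(x+2πkA) = Xe^{4πkA}`,
`e^{4πkA} - 1 ≥ 4πkA`, `X ≥ 1`), whence the geometric series. The printed constants follow in
`platt2016_lemma74_even/odd`. [cite: Platt2016GRH, Lemma 7.4 p. 3019] -/
theorem platt2016_lemma74 {q : ℕ} [NeZero q] (hq : 1 < q) {χ : DirichletCharacter ℂ q}
    (hχ : χ.IsPrimitive) {ε : ℂ} (hε : ‖ε‖ = 1) {η : ℝ} (hη : |η| < 1) (x : ℝ) {A : ℝ} (hA : 0 < A)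
    {δ X : ℝ} (hδ : δ = π / 2 * (1 - |η|)) (hX : X = π * δ * Real.exp (2 * x - δ) / q)
    (hX1 : 1 ≤ X) :
    ‖∑' k : ℕ, (1 / (2 * π) * ∫ t : ℝ, ε * (q : ℂ) ^ (I * t / 2) * (π : ℂ) ^ (-(1 / 2 + charParity χ + I * t) / 2) *
          Complex.Gamma ((1 / 2 + charParity χ + I * t) / 2) * Complex.exp (π * η * t / 4) *
          χ.LFunction (1 / 2 + I * t) * Complex.exp (-I * ((x + 2 * π * k * A : ℝ) : ℂ) * t))‖ ≤
      2 * Real.exp ((1 / 2 + charParity χ) * x - X) * (1 + 1 / (2 * X)) *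
        (q : ℝ) ^ (-((1 / 2 + (charParity χ : ℝ)) / 2)) / (1 - Real.exp (-(π * A))) := by
  set r : ℝ := Real.exp (-(π * A)) with hr
  have hr0 : 0 ≤ r := (Real.exp_pos _).le
  have hr1 : r < 1 := by rw [hr, Real.exp_lt_one_iff]; nlinarith [Real.pi_pos]
  set C₀ : ℝ := 2 * Real.exp ((1 / 2 + charParity χ) * x - X) * (1 + 1 / (2 * X)) *
    (q : ℝ) ^ (-((1 / 2 + (charParity χ : ℝ)) / 2)) with hC₀
  have hk : ∀ k : ℕ, ‖1 / (2 * π) * ∫ t : ℝ, ε * (q : ℂ) ^ (I * t / 2) * (π : ℂ) ^ (-(1 / 2 + charParity χ + I * t) / 2) *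
          Complex.Gamma ((1 / 2 + charParity χ + I * t) / 2) * Complex.exp (π * η * t / 4) *
          χ.LFunction (1 / 2 + I * t) * Complex.exp (-I * ((x + 2 * π * k * A : ℝ) : ℂ) * t)‖ ≤ C₀ * r ^ k :=
    fun k => norm_fourier_shift_le hq hχ hε hη x hA hδ hX hX1 k
  have hgeo : Summable fun k : ℕ => C₀ * r ^ k := (summable_geometric_of_lt_one hr0 hr1).mul_left C₀
  have hsum : Summable fun k : ℕ => ‖1 / (2 * π) * ∫ t : ℝ, ε * (q : ℂ) ^ (I * t / 2) * (π : ℂ) ^ (-(1 / 2 + charParity χ + I * t) / 2) *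
          Complex.Gamma ((1 / 2 + charParity χ + I * t) / 2) * Complex.exp (π * η * t / 4) *
          χ.LFunction (1 / 2 + I * t) * Complex.exp (-I * ((x + 2 * π * k * A : ℝ) : ℂ) * t)‖ :=
    Summable.of_nonneg_of_le (fun k => norm_nonneg _) hk hgeo
  calc _ ≤ ∑' k : ℕ, ‖1 / (2 * π) * ∫ t : ℝ, ε * (q : ℂ) ^ (I * t / 2) * (π : ℂ) ^ (-(1 / 2 + charParity χ + I * t) / 2) *
          Complex.Gamma ((1 / 2 + charParity χ + I * t) / 2) * Complex.exp (π * η * t / 4) *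
          χ.LFunction (1 / 2 + I * t) * Complex.exp (-I * ((x + 2 * π * k * A : ℝ) : ℂ) * t)‖ :=
        norm_tsum_le_tsum_norm hsum
    _ ≤ ∑' k : ℕ, C₀ * r ^ k := hsum.tsum_le_tsum hk hgeo
    _ = C₀ * (1 - r)⁻¹ := by rw [tsum_mul_left, tsum_geometric_of_lt_one hr0 hr1]
    _ = _ := by rw [hC₀, hr]; ring

/-- **Platt 2016, Lemma 7.4 (Booker), even case (Math. Comp. 85, p. 3019; arXiv:1305.3087v1
Lemma 5.4), as printed:** "Let `η ∈ (-1, 1)`, `δ := (π/2)(1 - |η|)` and `X(x) := πδe^{2x-δ}/q > 1`. Then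
`|Σ_{k=0}^∞ F̂_e(x + 2πkA, χ)| ≤ 4 exp(x/2 - X(x)) (1 + 1/(2X(x))) / (δ^{1/2} q^{1/4} (1 - e^{-πA}))`."
Here `χ` is an even primitive character mod `q > 1`, `|ε_χ| = 1`, `A > 0` (p. 3017: "choose
`A, B > 0`"), `F̂_e(y, χ) = (1/(2π)) ∫ F_e(t, χ) e^{-iyt} dt` with
`F_e(t, χ) = ε_χ q^{it/2} π^{-(1/2+it)/2} Γ((1/2+it)/2) exp(πηt/4) L_χ(1/2+it)` (p. 3017), `δ^{1/2} = √δ`,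
`q^{1/4}` the real `rpow`; `δ`, `X` enter through their defining equations. Platt: "This is Lemma 5.6 of
[3] specialised to Dirichlet `L`-functions"; proved here directly from Lemma 7.1 (`platt2016_lemma74`,
module docstring). [cite: Platt2016GRH, Lemma 7.4 p. 3019] -/
theorem platt2016_lemma74_even {q : ℕ} [NeZero q] (hq : 1 < q) {χ : DirichletCharacter ℂ q}
    (hχ : χ.IsPrimitive) (hχe : χ.Even) {ε : ℂ} (hε : ‖ε‖ = 1) {η : ℝ} (hη : |η| < 1) (x : ℝ)
    {A : ℝ} (hA : 0 < A) {δ X : ℝ} (hδ : δ = π / 2 * (1 - |η|))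
    (hX : X = π * δ * Real.exp (2 * x - δ) / q) (hX1 : 1 < X) :
    ‖∑' k : ℕ, (1 / (2 * π) * ∫ t : ℝ, ε * (q : ℂ) ^ (I * t / 2) *
        (π : ℂ) ^ (-(1 / 2 + I * t) / 2) * Complex.Gamma ((1 / 2 + I * t) / 2) *
        Complex.exp (π * η * t / 4) * χ.LFunction (1 / 2 + I * t) *
        Complex.exp (-I * ((x + 2 * π * k * A : ℝ) : ℂ) * t))‖ ≤
      4 * Real.exp (x / 2 - X) * (1 + 1 / (2 * X)) /
        (Real.sqrt δ * (q : ℝ) ^ (1 / 4 : ℝ) * (1 - Real.exp (-(π * A)))) := by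
  have h := platt2016_lemma74 hq hχ hε hη x hA hδ hX hX1.le
  rw [charParity_of_even hχe] at h
  have e1 : (1 / 2 : ℝ) * x - X = x / 2 - X := by ring
  have e2 : -((1 / 2 : ℝ) / 2) = -(1 / 4) := by norm_num
  simp only [Nat.cast_zero, add_zero, e1, e2] at h
  refine h.trans ?_
  have hX0 : 0 < X := by linarith
  have hδ0 : 0 < δ := by rw [hδ]; nlinarith [abs_nonneg η, Real.pi_pos, hη]
  have hsq : 0 < Real.sqrt δ := Real.sqrt_pos.2 hδ0
  have hsq2 := sqrt_delta_le_two hδ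
  have hr : 0 < 1 - Real.exp (-(π * A)) := by
    have : Real.exp (-(π * A)) < 1 := by rw [Real.exp_lt_one_iff]; nlinarith [Real.pi_pos]
    linarith
  have hqpos : (0 : ℝ) < q := by exact_mod_cast (show 0 < q by omega)
  have hq4 : 0 < (q : ℝ) ^ (1 / 4 : ℝ) := Real.rpow_pos_of_pos hqpos _
  rw [Real.rpow_neg hqpos.le]
  have key : 2 * Real.exp (x / 2 - X) * (1 + 1 / (2 * X)) * ((q : ℝ) ^ (1 / 4 : ℝ))⁻¹ /
      (1 - Real.exp (-(π * A))) =
      4 * Real.exp (x / 2 - X) * (1 + 1 / (2 * X)) /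
        (Real.sqrt δ * (q : ℝ) ^ (1 / 4 : ℝ) * (1 - Real.exp (-(π * A)))) * (Real.sqrt δ / 2) := by
    field_simp
    ring
  rw [key]
  have hR : 0 ≤ 4 * Real.exp (x / 2 - X) * (1 + 1 / (2 * X)) /
      (Real.sqrt δ * (q : ℝ) ^ (1 / 4 : ℝ) * (1 - Real.exp (-(π * A)))) := by positivity
  calc _ ≤ 4 * Real.exp (x / 2 - X) * (1 + 1 / (2 * X)) /
        (Real.sqrt δ * (q : ℝ) ^ (1 / 4 : ℝ) * (1 - Real.exp (-(π * A)))) * 1 := by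
        gcongr; linarith
    _ = _ := mul_one _

/-- **Platt 2016, Lemma 7.4 (Booker), odd case (Math. Comp. 85, p. 3019), as printed:**
`|Σ_{k=0}^∞ F̂_o(x + 2πkA, χ)| ≤ 4 exp(3x/2 - X(x)) (1 + 1/(2X(x)))^{3/2} / (δ^{1/2} q^{3/4} (1 - e^{-πA}))`,
`χ` an odd primitive character mod `q > 1`,
`F_o(t, χ) = ε_χ q^{it/2} π^{-(3/2+it)/2} Γ((3/2+it)/2) exp(πηt/4) L_χ(1/2+it)`; conventions as in
`platt2016_lemma74_even`. From `platt2016_lemma74` with `a = 1` and `1 + 1/(2X) ≤ (1 + 1/(2X))^{3/2}`.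
[cite: Platt2016GRH, Lemma 7.4 p. 3019] -/
theorem platt2016_lemma74_odd {q : ℕ} [NeZero q] (hq : 1 < q) {χ : DirichletCharacter ℂ q}
    (hχ : χ.IsPrimitive) (hχo : χ.Odd) {ε : ℂ} (hε : ‖ε‖ = 1) {η : ℝ} (hη : |η| < 1) (x : ℝ)
    {A : ℝ} (hA : 0 < A) {δ X : ℝ} (hδ : δ = π / 2 * (1 - |η|))
    (hX : X = π * δ * Real.exp (2 * x - δ) / q) (hX1 : 1 < X) :
    ‖∑' k : ℕ, (1 / (2 * π) * ∫ t : ℝ, ε * (q : ℂ) ^ (I * t / 2) *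
        (π : ℂ) ^ (-(3 / 2 + I * t) / 2) * Complex.Gamma ((3 / 2 + I * t) / 2) *
        Complex.exp (π * η * t / 4) * χ.LFunction (1 / 2 + I * t) *
        Complex.exp (-I * ((x + 2 * π * k * A : ℝ) : ℂ) * t))‖ ≤
      4 * Real.exp (3 * x / 2 - X) * (1 + 1 / (2 * X)) ^ (3 / 2 : ℝ) /
        (Real.sqrt δ * (q : ℝ) ^ (3 / 4 : ℝ) * (1 - Real.exp (-(π * A)))) := by
  have h := platt2016_lemma74 hq hχ hε hη x hA hδ hX hX1.le
  rw [charParity_of_odd hχo] at h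
  have e0 : (1 / 2 : ℂ) + 1 = 3 / 2 := by norm_num
  have e1 : ((1 / 2 : ℝ) + 1) * x - X = 3 * x / 2 - X := by ring
  have e2 : -(((1 / 2 : ℝ) + 1) / 2) = -(3 / 4) := by norm_num
  simp only [Nat.cast_one, e0, e1, e2] at h
  refine h.trans ?_
  have hX0 : 0 < X := by linarith
  have hδ0 : 0 < δ := by rw [hδ]; nlinarith [abs_nonneg η, Real.pi_pos, hη]
  have hsq : 0 < Real.sqrt δ := Real.sqrt_pos.2 hδ0
  have hsq2 := sqrt_delta_le_two hδ
  have hr : 0 < 1 - Real.exp (-(π * A)) := by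
    have : Real.exp (-(π * A)) < 1 := by rw [Real.exp_lt_one_iff]; nlinarith [Real.pi_pos]
    linarith
  have hqpos : (0 : ℝ) < q := by exact_mod_cast (show 0 < q by omega)
  have hq4 : 0 < (q : ℝ) ^ (3 / 4 : ℝ) := Real.rpow_pos_of_pos hqpos _
  have hP : 1 + 1 / (2 * X) ≤ (1 + 1 / (2 * X)) ^ (3 / 2 : ℝ) :=
    Real.self_le_rpow_of_one_le (le_add_of_nonneg_right (by positivity)) (by norm_num)
  rw [Real.rpow_neg hqpos.le]
  have key : 2 * Real.exp (3 * x / 2 - X) * (1 + 1 / (2 * X)) * ((q : ℝ) ^ (3 / 4 : ℝ))⁻¹ /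
      (1 - Real.exp (-(π * A))) =
      4 * Real.exp (3 * x / 2 - X) * (1 + 1 / (2 * X)) /
        (Real.sqrt δ * (q : ℝ) ^ (3 / 4 : ℝ) * (1 - Real.exp (-(π * A)))) * (Real.sqrt δ / 2) := by
    field_simp
    ring
  rw [key]
  have hR : 0 ≤ 4 * Real.exp (3 * x / 2 - X) /
      (Real.sqrt δ * (q : ℝ) ^ (3 / 4 : ℝ) * (1 - Real.exp (-(π * A)))) := by positivity
  calc 4 * Real.exp (3 * x / 2 - X) * (1 + 1 / (2 * X)) /
        (Real.sqrt δ * (q : ℝ) ^ (3 / 4 : ℝ) * (1 - Real.exp (-(π * A)))) * (Real.sqrt δ / 2)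
      = 4 * Real.exp (3 * x / 2 - X) /
        (Real.sqrt δ * (q : ℝ) ^ (3 / 4 : ℝ) * (1 - Real.exp (-(π * A)))) * (1 + 1 / (2 * X)) *
          (Real.sqrt δ / 2) := by ring
    _ ≤ 4 * Real.exp (3 * x / 2 - X) /
        (Real.sqrt δ * (q : ℝ) ^ (3 / 4 : ℝ) * (1 - Real.exp (-(π * A)))) *
          (1 + 1 / (2 * X)) ^ (3 / 2 : ℝ) * 1 := by
        gcongr; linarith
    _ = _ := by ring

namespace FourierTail

/-! ## §4 Lemma 7.5: folding the two-sided periodisation onto two tails -/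

/-- If `F` is real valued then `F̂(-y) = conj F̂(y)` for `F̂(y) = (1/(2π)) ∫ F(t) e^{-iyt} dt` — the step
"`F_e(x, χ)` is real valued, so `F̂_e(x, χ) = conj F̂_e(-x, χ)`" of the proof of Lemma 7.5 (generic in `F`).
[folklore] -/
private theorem fourier_neg_eq_conj (F : ℝ → ℂ) (hreal : ∀ t : ℝ, (F t).im = 0) (Fhat : ℝ → ℂ)
    (hFhat : ∀ y : ℝ, Fhat y = 1 / (2 * π) * ∫ t : ℝ, F t * Complex.exp (-I * y * t)) (y : ℝ) :
    Fhat (-y) = starRingEnd ℂ (Fhat y) := by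
  rw [hFhat, hFhat, map_mul]
  have hc : starRingEnd ℂ (1 / (2 * π) : ℂ) = 1 / (2 * π) := by
    rw [show (1 / (2 * π) : ℂ) = ((1 / (2 * π) : ℝ) : ℂ) by push_cast; ring, Complex.conj_ofReal]
  rw [hc, ← integral_conj]
  congr 1
  refine integral_congr_ae (ae_of_all _ fun t => ?_)
  simp only
  rw [map_mul, Complex.conj_eq_iff_im.mpr (hreal t), ← Complex.exp_conj, map_mul, map_mul,
    map_neg, Complex.conj_I, Complex.conj_ofReal, Complex.conj_ofReal]
  push_cast
  ring_nf

/-- `‖Σ_{k ∈ ℤ} G(k) - G(0)‖ ≤ ‖Σ_{j ≥ 0} G(j+1)‖ + ‖Σ_{j ≥ 0} G(-(j+1))‖` when both tails are summable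
(Mathlib's `tsum_of_nat_of_neg_add_one`). [folklore] -/
private theorem norm_tsum_int_sub_le (G : ℤ → ℂ) (hs1 : Summable fun j : ℕ => G ((j : ℤ) + 1))
    (hs2 : Summable fun j : ℕ => G (-((j : ℤ) + 1))) :
    ‖(∑' k : ℤ, G k) - G 0‖ ≤ ‖∑' j : ℕ, G ((j : ℤ) + 1)‖ + ‖∑' j : ℕ, G (-((j : ℤ) + 1))‖ := by
  have hs1' : Summable fun j : ℕ => G (j : ℤ) := by
    have : Summable fun j : ℕ => G ((j + 1 : ℕ) : ℤ) := by simpa [Nat.cast_succ] using hs1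
    exact (summable_nat_add_iff 1).mp this
  rw [tsum_of_nat_of_neg_add_one hs1' hs2, hs1'.tsum_eq_zero_add]
  simp only [Nat.cast_zero, Nat.cast_succ]
  have : G 0 + ∑' j : ℕ, G ((j : ℤ) + 1) + ∑' j : ℕ, G (-((j : ℤ) + 1)) - G 0 =
      ∑' j : ℕ, G ((j : ℤ) + 1) + ∑' j : ℕ, G (-((j : ℤ) + 1)) := by ring
  rw [this]
  exact norm_add_le _ _

end FourierTail

/-- **Platt 2016, Lemma 7.5, even case (Math. Comp. 85, p. 3019; arXiv:1305.3087v1 Lemma 5.5), as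
printed:** "Let `A ≥ 1/(2π)`, `B > 0`, `w₁ = 2πn/B + 2πA`, `w₂ = -2πn/B + 2πA`, with `X(x)` and `δ` as
defined in Lemma 7.4 and `X(w₁), X(w₂) > 1`. Then
`|F̃̂_e(n, χ) - F̂_e(2πn/B, χ)| ≤ 4 (exp(w₁/2 - X(w₁))(1 + 1/(2X(w₁))) + exp(w₂/2 - X(w₂))(1 + 1/(2X(w₂)))) / (q^{1/4} δ^{1/2} (1 - e^{-πA}))`."
Here `F̃̂_e(n, χ) := Σ_{k ∈ ℤ} F̂_e(2πn/B + 2πkA, χ)` (p. 3017), `F̂_e` is the function `Fhat` with its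
defining equation `hFhat` (`F̂_e(y, χ) = (1/(2π)) ∫ F_e(t, χ) e^{-iyt} dt`, `F_e` as in
`platt2016_lemma74_even`), `χ` even primitive mod `q > 1`, `|ε_χ| = 1`, `|η| < 1`, `n ∈ ℤ`, and — the
printed proof's "Now, `F_e(x, χ)` is real valued" (Platt's choice of `ε_χ`, p. 3009) — `hreal`: `F_e(t, χ) ∈ ℝ`
for all `t`. Only `A > 0` is needed (`B` arbitrary). Proof as printed: split `Σ_{k ∈ ℤ}` at `k = 0`; the
`k ≥ 1` part is `Σ_{j ≥ 0} F̂_e(w₁ + 2πjA)`, the `k ≤ -1` part is `conj Σ_{j ≥ 0} F̂_e(w₂ + 2πjA)`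
(`FourierTail.fourier_neg_eq_conj`), both bounded by `platt2016_lemma74_even`.
[cite: Platt2016GRH, Lemma 7.5 p. 3019] -/
theorem platt2016_lemma75_even {q : ℕ} [NeZero q] (hq : 1 < q) {χ : DirichletCharacter ℂ q}
    (hχ : χ.IsPrimitive) (hχe : χ.Even) {ε : ℂ} (hε : ‖ε‖ = 1) {η : ℝ} (hη : |η| < 1)
    (hreal : ∀ t : ℝ, (ε * (q : ℂ) ^ (I * t / 2) *
        (π : ℂ) ^ (-(1 / 2 + I * t) / 2) * Complex.Gamma ((1 / 2 + I * t) / 2) *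
        Complex.exp (π * η * t / 4) * χ.LFunction (1 / 2 + I * t)).im = 0)
    (Fhat : ℝ → ℂ) (hFhat : ∀ y : ℝ, Fhat y = 1 / (2 * π) * ∫ t : ℝ, ε * (q : ℂ) ^ (I * t / 2) *
        (π : ℂ) ^ (-(1 / 2 + I * t) / 2) * Complex.Gamma ((1 / 2 + I * t) / 2) *
        Complex.exp (π * η * t / 4) * χ.LFunction (1 / 2 + I * t) * Complex.exp (-I * y * t))
    {A : ℝ} (hA : 0 < A) (B : ℝ) (n : ℤ) {δ : ℝ} (hδ : δ = π / 2 * (1 - |η|))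
    {w₁ w₂ X₁ X₂ : ℝ} (hw₁ : w₁ = 2 * π * n / B + 2 * π * A) (hw₂ : w₂ = -(2 * π * n / B) + 2 * π * A)
    (hX₁ : X₁ = π * δ * Real.exp (2 * w₁ - δ) / q) (hX₂ : X₂ = π * δ * Real.exp (2 * w₂ - δ) / q)
    (hX₁1 : 1 < X₁) (hX₂1 : 1 < X₂) :
    ‖(∑' k : ℤ, Fhat (2 * π * n / B + 2 * π * k * A)) - Fhat (2 * π * n / B)‖ ≤
      4 * (Real.exp (w₁ / 2 - X₁) * (1 + 1 / (2 * X₁)) + Real.exp (w₂ / 2 - X₂) * (1 + 1 / (2 * X₂))) /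
        ((q : ℝ) ^ (1 / 4 : ℝ) * Real.sqrt δ * (1 - Real.exp (-(π * A)))) := by
  set G : ℤ → ℂ := fun k => Fhat (2 * π * n / B + 2 * π * k * A) with hG
  have hG0 : G 0 = Fhat (2 * π * n / B) := by simp [hG]
  have hG1 : ∀ j : ℕ, G ((j : ℤ) + 1) = Fhat (w₁ + 2 * π * j * A) := by
    intro j; simp only [hG]; congr 1; push_cast; rw [hw₁]; ring
  have hG2 : ∀ j : ℕ, G (-((j : ℤ) + 1)) = starRingEnd ℂ (Fhat (w₂ + 2 * π * j * A)) := by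
    intro j; simp only [hG]
    have : (2 * π * n / B + 2 * π * ((-((j : ℤ) + 1) : ℤ) : ℝ) * A) = -(w₂ + 2 * π * j * A) := by
      push_cast; rw [hw₂]; ring
    rw [this]
    exact fourier_neg_eq_conj _ hreal Fhat hFhat _
  -- termwise bounds for summability (from the shift bound, specialised to `a = 0`)
  have hshift : ∀ (w X : ℝ), X = π * δ * Real.exp (2 * w - δ) / q → 1 ≤ X → ∀ j : ℕ,
      ‖Fhat (w + 2 * π * j * A)‖ ≤ 2 * Real.exp (1 / 2 * w - X) * (1 + 1 / (2 * X)) *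
        (q : ℝ) ^ (-((1 / 2 : ℝ) / 2)) * Real.exp (-(π * A)) ^ j := by
    intro w X hXw hX1w j
    have h := norm_fourier_shift_le hq hχ hε hη w hA hδ hXw hX1w j
    rw [charParity_of_even hχe] at h
    simp only [Nat.cast_zero, add_zero] at h
    rw [hFhat]
    exact h
  have hr0 : 0 ≤ Real.exp (-(π * A)) := (Real.exp_pos _).le
  have hr1 : Real.exp (-(π * A)) < 1 := by rw [Real.exp_lt_one_iff]; nlinarith [Real.pi_pos]
  set C₁ : ℝ := 2 * Real.exp (1 / 2 * w₁ - X₁) * (1 + 1 / (2 * X₁)) *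
    (q : ℝ) ^ (-((1 / 2 : ℝ) / 2)) with hC₁
  set C₂ : ℝ := 2 * Real.exp (1 / 2 * w₂ - X₂) * (1 + 1 / (2 * X₂)) *
    (q : ℝ) ^ (-((1 / 2 : ℝ) / 2)) with hC₂
  have hs1 : Summable fun j : ℕ => G ((j : ℤ) + 1) := by
    refine Summable.of_norm_bounded ((summable_geometric_of_lt_one hr0 hr1).mul_left C₁) fun j => ?_
    rw [hG1]; exact hshift w₁ X₁ hX₁ hX₁1.le j
  have hs2 : Summable fun j : ℕ => G (-((j : ℤ) + 1)) := by
    refine Summable.of_norm_bounded ((summable_geometric_of_lt_one hr0 hr1).mul_left C₂) fun j => ?_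
    rw [hG2, Complex.norm_conj]; exact hshift w₂ X₂ hX₂ hX₂1.le j
  have hsplit := norm_tsum_int_sub_le G hs1 hs2
  rw [hG0] at hsplit
  refine hsplit.trans ?_
  -- the two one-sided sums, by Lemma 7.4
  have hb1 : ‖∑' j : ℕ, G ((j : ℤ) + 1)‖ ≤ 4 * Real.exp (w₁ / 2 - X₁) * (1 + 1 / (2 * X₁)) /
      (Real.sqrt δ * (q : ℝ) ^ (1 / 4 : ℝ) * (1 - Real.exp (-(π * A)))) := by
    have h := platt2016_lemma74_even hq hχ hχe hε hη w₁ hA hδ hX₁ hX₁1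
    simp_rw [hG1, hFhat]
    exact h
  have hb2 : ‖∑' j : ℕ, G (-((j : ℤ) + 1))‖ ≤ 4 * Real.exp (w₂ / 2 - X₂) * (1 + 1 / (2 * X₂)) /
      (Real.sqrt δ * (q : ℝ) ^ (1 / 4 : ℝ) * (1 - Real.exp (-(π * A)))) := by
    have h := platt2016_lemma74_even hq hχ hχe hε hη w₂ hA hδ hX₂ hX₂1
    simp_rw [hG2]
    rw [← Complex.conj_tsum, Complex.norm_conj]
    simp_rw [hFhat]
    exact h
  refine (add_le_add hb1 hb2).trans (le_of_eq ?_)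
  ring

/-- **Platt 2016, Lemma 7.5, odd case (Math. Comp. 85, p. 3019), as printed:**
`|F̃̂_o(n, χ) - F̂_o(2πn/B, χ)| ≤ 4 (exp(3w₁/2 - X(w₁))(1 + 1/(2X(w₁)))^{3/2} + exp(3w₂/2 - X(w₂))(1 + 1/(2X(w₂)))^{3/2}) / (q^{3/4} δ^{1/2} (1 - e^{-πA}))`,
conventions as in `platt2016_lemma75_even` with `F_o` (`χ` odd) in place of `F_e` ("the odd case being
identical", p. 3019). [cite: Platt2016GRH, Lemma 7.5 p. 3019] -/
theorem platt2016_lemma75_odd {q : ℕ} [NeZero q] (hq : 1 < q) {χ : DirichletCharacter ℂ q}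
    (hχ : χ.IsPrimitive) (hχo : χ.Odd) {ε : ℂ} (hε : ‖ε‖ = 1) {η : ℝ} (hη : |η| < 1)
    (hreal : ∀ t : ℝ, (ε * (q : ℂ) ^ (I * t / 2) *
        (π : ℂ) ^ (-(3 / 2 + I * t) / 2) * Complex.Gamma ((3 / 2 + I * t) / 2) *
        Complex.exp (π * η * t / 4) * χ.LFunction (1 / 2 + I * t)).im = 0)
    (Fhat : ℝ → ℂ) (hFhat : ∀ y : ℝ, Fhat y = 1 / (2 * π) * ∫ t : ℝ, ε * (q : ℂ) ^ (I * t / 2) *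
        (π : ℂ) ^ (-(3 / 2 + I * t) / 2) * Complex.Gamma ((3 / 2 + I * t) / 2) *
        Complex.exp (π * η * t / 4) * χ.LFunction (1 / 2 + I * t) * Complex.exp (-I * y * t))
    {A : ℝ} (hA : 0 < A) (B : ℝ) (n : ℤ) {δ : ℝ} (hδ : δ = π / 2 * (1 - |η|))
    {w₁ w₂ X₁ X₂ : ℝ} (hw₁ : w₁ = 2 * π * n / B + 2 * π * A) (hw₂ : w₂ = -(2 * π * n / B) + 2 * π * A)
    (hX₁ : X₁ = π * δ * Real.exp (2 * w₁ - δ) / q) (hX₂ : X₂ = π * δ * Real.exp (2 * w₂ - δ) / q)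
    (hX₁1 : 1 < X₁) (hX₂1 : 1 < X₂) :
    ‖(∑' k : ℤ, Fhat (2 * π * n / B + 2 * π * k * A)) - Fhat (2 * π * n / B)‖ ≤
      4 * (Real.exp (3 * w₁ / 2 - X₁) * (1 + 1 / (2 * X₁)) ^ (3 / 2 : ℝ) +
          Real.exp (3 * w₂ / 2 - X₂) * (1 + 1 / (2 * X₂)) ^ (3 / 2 : ℝ)) /
        ((q : ℝ) ^ (3 / 4 : ℝ) * Real.sqrt δ * (1 - Real.exp (-(π * A)))) := by
  set G : ℤ → ℂ := fun k => Fhat (2 * π * n / B + 2 * π * k * A) with hG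
  have hG0 : G 0 = Fhat (2 * π * n / B) := by simp [hG]
  have hG1 : ∀ j : ℕ, G ((j : ℤ) + 1) = Fhat (w₁ + 2 * π * j * A) := by
    intro j; simp only [hG]; congr 1; push_cast; rw [hw₁]; ring
  have hG2 : ∀ j : ℕ, G (-((j : ℤ) + 1)) = starRingEnd ℂ (Fhat (w₂ + 2 * π * j * A)) := by
    intro j; simp only [hG]
    have : (2 * π * n / B + 2 * π * ((-((j : ℤ) + 1) : ℤ) : ℝ) * A) = -(w₂ + 2 * π * j * A) := by
      push_cast; rw [hw₂]; ring
    rw [this]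
    exact fourier_neg_eq_conj _ hreal Fhat hFhat _
  have hshift : ∀ (w X : ℝ), X = π * δ * Real.exp (2 * w - δ) / q → 1 ≤ X → ∀ j : ℕ,
      ‖Fhat (w + 2 * π * j * A)‖ ≤ 2 * Real.exp ((1 / 2 + 1) * w - X) * (1 + 1 / (2 * X)) *
        (q : ℝ) ^ (-((1 / 2 + (1 : ℝ)) / 2)) * Real.exp (-(π * A)) ^ j := by
    intro w X hXw hX1w j
    have h := norm_fourier_shift_le hq hχ hε hη w hA hδ hXw hX1w j
    rw [charParity_of_odd hχo] at h
    have e0 : (1 / 2 : ℂ) + 1 = 3 / 2 := by norm_num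
    simp only [Nat.cast_one, e0] at h
    rw [hFhat]
    exact h
  have hr0 : 0 ≤ Real.exp (-(π * A)) := (Real.exp_pos _).le
  have hr1 : Real.exp (-(π * A)) < 1 := by rw [Real.exp_lt_one_iff]; nlinarith [Real.pi_pos]
  set C₁ : ℝ := 2 * Real.exp ((1 / 2 + 1) * w₁ - X₁) * (1 + 1 / (2 * X₁)) *
    (q : ℝ) ^ (-((1 / 2 + (1 : ℝ)) / 2)) with hC₁
  set C₂ : ℝ := 2 * Real.exp ((1 / 2 + 1) * w₂ - X₂) * (1 + 1 / (2 * X₂)) *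
    (q : ℝ) ^ (-((1 / 2 + (1 : ℝ)) / 2)) with hC₂
  have hs1 : Summable fun j : ℕ => G ((j : ℤ) + 1) := by
    refine Summable.of_norm_bounded ((summable_geometric_of_lt_one hr0 hr1).mul_left C₁) fun j => ?_
    rw [hG1]; exact hshift w₁ X₁ hX₁ hX₁1.le j
  have hs2 : Summable fun j : ℕ => G (-((j : ℤ) + 1)) := by
    refine Summable.of_norm_bounded ((summable_geometric_of_lt_one hr0 hr1).mul_left C₂) fun j => ?_
    rw [hG2, Complex.norm_conj]; exact hshift w₂ X₂ hX₂ hX₂1.le j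
  have hsplit := norm_tsum_int_sub_le G hs1 hs2
  rw [hG0] at hsplit
  refine hsplit.trans ?_
  have hb1 : ‖∑' j : ℕ, G ((j : ℤ) + 1)‖ ≤ 4 * Real.exp (3 * w₁ / 2 - X₁) *
      (1 + 1 / (2 * X₁)) ^ (3 / 2 : ℝ) /
      (Real.sqrt δ * (q : ℝ) ^ (3 / 4 : ℝ) * (1 - Real.exp (-(π * A)))) := by
    have h := platt2016_lemma74_odd hq hχ hχo hε hη w₁ hA hδ hX₁ hX₁1
    simp_rw [hG1, hFhat]
    exact h
  have hb2 : ‖∑' j : ℕ, G (-((j : ℤ) + 1))‖ ≤ 4 * Real.exp (3 * w₂ / 2 - X₂) *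
      (1 + 1 / (2 * X₂)) ^ (3 / 2 : ℝ) /
      (Real.sqrt δ * (q : ℝ) ^ (3 / 4 : ℝ) * (1 - Real.exp (-(π * A)))) := by
    have h := platt2016_lemma74_odd hq hχ hχo hε hη w₂ hA hδ hX₂ hX₂1
    simp_rw [hG2]
    rw [← Complex.conj_tsum, Complex.norm_conj]
    simp_rw [hFhat]
    exact h
  refine (add_le_add hb1 hb2).trans (le_of_eq ?_)
  ring

end Literature.NumberTheory.LFunctions

end
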